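import Summits.QuantumFields.YangMills.Theorems.CurvatureKernelBound.Negative.L1Extension

/-!
# `CurvatureKernelBound` — negative lemmas, chain C III: the two-point functional of an ADMISSIBLE kernel (generic)

Supports crux item `stmt-QuantumFields-11687` (`PencilRigidity.CurvatureKernelBound`). Standing disprover's negative
lemmas (refuter, cdisprove cycle 3), chain C: the dimension-5 generalised free field through the generic admissible-kernel
pipeline, culminating in `GFF.not_axialGrowthOfEuclideanPackage` (even full `O(4)`-invariance on `⁰𝒮` and E2 in EVERY frame
do not bound the order of the two-point singularity). No conclusion below asserts a Theses statement positively.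

`AdmissibleKernel K` (measurable, `≥ 0`, continuous off `0`, even, `θ`-invariant, `K ≤ A‖·‖⁻¹⁰` off `0`, time decay
`K(w − te₀) ≤ B e^{-t}(1 + K w)`); for such `K`: domination `‖K(x₀−x₁)F(x)‖ ≤ A·3⁹(1+‖x‖)⁻⁹ SN 9 10 F` on `⁰𝒮` (via
`L1Witness.norm_le_flat_of_isOffDiagonal`), integrability, seminorm bound, the functional `ℓ` on `⁰𝒮`, Hahn–Banach
(`exists_extension_of_le_sublinear` + `Module.Dual.extendRCLike`), and the continuous linear functional `T hK` with
`T_eq_integral` on `⁰𝒮`. [folklore]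
-/

open scoped BigOperators Topology SchwartzMap
open MeasureTheory Filter Set Real
open Literature.MathematicalPhysics.QuantumLattice Literature.MathematicalPhysics.AQFT

noncomputable section

namespace Summit.QuantumFields.YangMills.Theorems.CurvatureKernelBound.Negative

namespace KernelWitness

open L1Witness (SN SN_nonneg norm_le_SN SN_mono_right norm_le_flat_of_isOffDiagonal wt wt_nonneg integrable_wt
  offDiag mem_offDiag real_smul_eq seminormFamily_eq SN_le_sup)

/-- **Admissible kernels**: the hypotheses under which the Hahn–Banach two-point functional of `K(x₀ − x₁)` exists
and carries the translation / swap / hermiticity / clustering clauses of the two-point package: measurable, non-negative,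
continuous off `0`, even, invariant under time reflection, `K ≤ A‖·‖⁻¹⁰` off `0`, and the time-decay inequality
`K(w − t e₀) ≤ B e^{-t} (1 + K(w))` for `w⁰ ≤ 0`, `w ≠ 0`, `t ≥ 0`. -/
structure AdmissibleKernel (K : E4 → ℝ) where
  measurable : Measurable K
  nonneg : ∀ w, 0 ≤ K w
  continuousOn : ContinuousOn K {w : E4 | w ≠ 0}
  even : ∀ w, K (-w) = K w
  theta : ∀ w, K (timeReflection 4 w) = K w
  A : ℝ
  A_nonneg : 0 ≤ A
  le : ∀ w : E4, w ≠ 0 → K w ≤ A * ‖w‖⁻¹ ^ 10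
  B : ℝ
  B_nonneg : 0 ≤ B
  timeDecay : ∀ w : E4, w 0 ≤ 0 → w ≠ 0 → ∀ t : ℝ, 0 ≤ t →
    K (w - EuclideanSpace.single 0 t) ≤ B * Real.exp (-t) * (1 + K w)

variable {K : E4 → ℝ}
variable {K : E4 → ℝ}

/-! ### The two-point integrand `K(x₀−x₁) F(x)`: domination, integrability, seminorm bound -/

section Integrand

/-- The kernel on configurations, complex-valued: `KC K x = K(x₀ − x₁)`. -/
def KC (K : E4 → ℝ) (x : Fin 2 → E4) : ℂ := (K (x 0 - x 1) : ℂ)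

/-- Auxiliary fact `KC_apply` of the generalised-free-field witness (see the module docstring). [folklore] -/
theorem KC_apply (K : E4 → ℝ) (x : Fin 2 → E4) : KC K x = (K (x 0 - x 1) : ℂ) := rfl

/-- Auxiliary fact `measurable_KC` of the generalised-free-field witness (see the module docstring). [folklore] -/
theorem measurable_KC (hK : AdmissibleKernel K) : Measurable (KC K) :=
  Complex.measurable_ofReal.comp (hK.measurable.comp ((measurable_pi_apply 0).sub (measurable_pi_apply 1)))

/-- Auxiliary fact `norm_KC` of the generalised-free-field witness (see the module docstring). [folklore] -/
theorem norm_KC (hK : AdmissibleKernel K) (x : Fin 2 → E4) : ‖KC K x‖ = K (x 0 - x 1) := by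
  rw [KC, Complex.norm_real, Real.norm_of_nonneg (hK.nonneg _)]

/-- The domination constant `A · 3⁹`. -/
def Cdom (hK : AdmissibleKernel K) : ℝ := hK.A * 3 ^ 9

/-- Auxiliary fact `Cdom_nonneg` of the generalised-free-field witness (see the module docstring). [folklore] -/
theorem Cdom_nonneg (hK : AdmissibleKernel K) : 0 ≤ Cdom hK := by unfold Cdom; exact mul_nonneg hK.A_nonneg (by positivity)

/-- **Domination**: for an off-diagonal `F`, `‖K(x₀−x₁) F(x)‖ ≤ 9!·3⁹ (1+‖x‖)⁻⁹ SN 9 10 F`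
(near the diagonal the `‖x₀−x₁‖⁻¹⁰` of the kernel is paid by ten orders of flatness). -/
theorem norm_KC_mul_le (hK : AdmissibleKernel K) {F : 𝓢((Fin 2 → E4), ℂ)} (hF : IsOffDiagonal F)
    (x : Fin 2 → E4) : ‖KC K x * F x‖ ≤ Cdom hK * wt x * SN 9 10 F := by
  have hA := hK.A_nonneg
  have hrhs : 0 ≤ Cdom hK * wt x * SN 9 10 F :=
    mul_nonneg (mul_nonneg (Cdom_nonneg hK) (wt_nonneg x)) (SN_nonneg _ _ _)
  by_cases hw : x 0 - x 1 = 0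
  · have hx : x ∈ coincidenceLocus 2 E4 := ⟨0, 1, by decide, sub_eq_zero.1 hw⟩
    rw [hF.apply_eq_zero hx, mul_zero, norm_zero]
    exact hrhs
  rw [norm_mul, norm_KC hK]
  have hKle := hK.le _ hw
  have hwpos : 0 < ‖x 0 - x 1‖ := norm_pos_iff.2 hw
  by_cases h1 : ‖x 0 - x 1‖ ≤ 1
  · have hFx := norm_le_flat_of_isOffDiagonal hF 9 10 x h1
    have hprod : ‖x 0 - x 1‖⁻¹ ^ 10 * (‖x 0 - x 1‖ / 2) ^ 10 = (1 / 2) ^ 10 := by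
      rw [← mul_pow]; congr 1; field_simp
    calc K (x 0 - x 1) * ‖F x‖
        ≤ (hK.A * ‖x 0 - x 1‖⁻¹ ^ 10) *
            (3 ^ 9 * (‖x 0 - x 1‖ / 2) ^ 10 * (1 + ‖x‖)⁻¹ ^ 9 * SN 9 10 F) :=
          mul_le_mul hKle hFx (norm_nonneg _) (by positivity)
      _ = hK.A * 3 ^ 9 * (‖x 0 - x 1‖⁻¹ ^ 10 * (‖x 0 - x 1‖ / 2) ^ 10) *
            (1 + ‖x‖)⁻¹ ^ 9 * SN 9 10 F := by ring
      _ = hK.A * 3 ^ 9 * (1 / 2) ^ 10 * (1 + ‖x‖)⁻¹ ^ 9 * SN 9 10 F := by rw [hprod]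
      _ ≤ hK.A * 3 ^ 9 * 1 * (1 + ‖x‖)⁻¹ ^ 9 * SN 9 10 F := by
          gcongr; norm_num
      _ = Cdom hK * wt x * SN 9 10 F := by rw [Cdom, wt]; ring
  · have h1' : 1 < ‖x 0 - x 1‖ := lt_of_not_ge h1
    have hinv : ‖x 0 - x 1‖⁻¹ ^ 10 ≤ 1 := pow_le_one₀ (by positivity) (inv_le_one_of_one_le₀ h1'.le)
    have hK' : K (x 0 - x 1) ≤ hK.A := by
      calc K (x 0 - x 1) ≤ hK.A * ‖x 0 - x 1‖⁻¹ ^ 10 := hKle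
        _ ≤ hK.A * 1 := by gcongr
        _ = hK.A := mul_one _
    have hFx : ‖F x‖ ≤ 2 ^ 9 * (1 + ‖x‖)⁻¹ ^ 9 * SN 9 10 F :=
      (norm_le_SN F 9 x).trans (by
        gcongr
        exact SN_mono_right (Nat.zero_le 10) F)
    calc K (x 0 - x 1) * ‖F x‖ ≤ hK.A * (2 ^ 9 * (1 + ‖x‖)⁻¹ ^ 9 * SN 9 10 F) :=
          mul_le_mul hK' hFx (norm_nonneg _) (by positivity)
      _ ≤ hK.A * (3 ^ 9 * (1 + ‖x‖)⁻¹ ^ 9 * SN 9 10 F) := by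
          gcongr; norm_num
      _ = Cdom hK * wt x * SN 9 10 F := by rw [Cdom, wt]; ring

/-- Auxiliary fact `aestronglyMeasurable_KC_mul` of the generalised-free-field witness (see the module docstring). [folklore] -/
theorem aestronglyMeasurable_KC_mul (hK : AdmissibleKernel K) (F : 𝓢((Fin 2 → E4), ℂ)) :
    AEStronglyMeasurable (fun x => KC K x * F x) volume :=
  ((measurable_KC hK).aestronglyMeasurable).mul F.continuous.aestronglyMeasurable

/-- **Integrability** of `K(x₀−x₁) F(x)` for off-diagonal `F`. -/
theorem integrable_KC_mul (hK : AdmissibleKernel K) {F : 𝓢((Fin 2 → E4), ℂ)} (hF : IsOffDiagonal F) :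
    Integrable (fun x => KC K x * F x) :=
  Integrable.mono' ((integrable_wt.const_mul (Cdom hK)).mul_const (SN 9 10 F))
    (aestronglyMeasurable_KC_mul hK F) (ae_of_all _ (norm_KC_mul_le hK hF))

/-- The constant of the seminorm bound. -/
def Cbd (hK : AdmissibleKernel K) : ℝ := Cdom hK * ∫ x, wt x

/-- Auxiliary fact `Cbd_nonneg` of the generalised-free-field witness (see the module docstring). [folklore] -/
theorem Cbd_nonneg (hK : AdmissibleKernel K) : 0 ≤ Cbd hK :=
  mul_nonneg (Cdom_nonneg hK) (integral_nonneg wt_nonneg)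

/-- **Seminorm bound** `‖∫ K F‖ ≤ Cbd · SN 9 10 F` on `⁰𝒮`. -/
theorem norm_integral_KC_mul_le (hK : AdmissibleKernel K) {F : 𝓢((Fin 2 → E4), ℂ)} (hF : IsOffDiagonal F) :
    ‖∫ x, KC K x * F x‖ ≤ Cbd hK * SN 9 10 F := by
  calc ‖∫ x, KC K x * F x‖ ≤ ∫ x, Cdom hK * wt x * SN 9 10 F :=
        norm_integral_le_of_norm_le ((integrable_wt.const_mul (Cdom hK)).mul_const (SN 9 10 F))
          (ae_of_all _ (norm_KC_mul_le hK hF))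
    _ = Cbd hK * SN 9 10 F := by
        rw [integral_mul_const, integral_const_mul, Cbd]

end Integrand

/-! ### `⁰𝒮` as a subspace, the functional `ℓ F = ∫ K F`, and a continuous extension `T` -/

section Extension

/-- The functional `ℓ F = ∫ K(x₀−x₁) F(x) dx` (meaningful on `⁰𝒮`). -/
def ell (K : E4 → ℝ) (F : 𝓢((Fin 2 → E4), ℂ)) : ℂ := ∫ x, KC K x * F x

/-- Auxiliary fact `ell_add` of the generalised-free-field witness (see the module docstring). [folklore] -/
theorem ell_add (hK : AdmissibleKernel K) {F G : 𝓢((Fin 2 → E4), ℂ)} (hF : IsOffDiagonal F)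
    (hG : IsOffDiagonal G) : ell K (F + G) = ell K F + ell K G := by
  have h : ∀ x, (F + G) x = F x + G x := fun _ => rfl
  simp only [ell, h, mul_add]
  exact integral_add (integrable_KC_mul hK hF) (integrable_KC_mul hK hG)

/-- Auxiliary fact `ell_smul` of the generalised-free-field witness (see the module docstring). [folklore] -/
theorem ell_smul (K : E4 → ℝ) (c : ℂ) (F : 𝓢((Fin 2 → E4), ℂ)) : ell K (c • F) = c * ell K F := by
  have h : ∀ x, (c • F) x = c * F x := fun _ => rfl
  simp only [ell, h, ← integral_const_mul]
  congr 1; funext x; ring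

/-- Auxiliary fact `norm_ell_le` of the generalised-free-field witness (see the module docstring). [folklore] -/
theorem norm_ell_le (hK : AdmissibleKernel K) {F : 𝓢((Fin 2 → E4), ℂ)} (hF : IsOffDiagonal F) :
    ‖ell K F‖ ≤ Cbd hK * SN 9 10 F :=
  norm_integral_KC_mul_le hK hF

/-- The dominating seminorm `N F = Cbd · SN 9 10 F`. -/
def Nsem (hK : AdmissibleKernel K) (F : 𝓢((Fin 2 → E4), ℂ)) : ℝ := Cbd hK * SN 9 10 F

/-- Auxiliary fact `Nsem_smul` of the generalised-free-field witness (see the module docstring). [folklore] -/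
theorem Nsem_smul (hK : AdmissibleKernel K) (c : ℂ) (F : 𝓢((Fin 2 → E4), ℂ)) :
    Nsem hK (c • F) = ‖c‖ * Nsem hK F := by
  simp only [Nsem, SN, map_smul_eq_mul]; ring

/-- Auxiliary fact `Nsem_add` of the generalised-free-field witness (see the module docstring). [folklore] -/
theorem Nsem_add (hK : AdmissibleKernel K) (F G : 𝓢((Fin 2 → E4), ℂ)) :
    Nsem hK (F + G) ≤ Nsem hK F + Nsem hK G := by
  simp only [Nsem, SN]
  rw [← mul_add]
  exact mul_le_mul_of_nonneg_left (map_add_le_add _ F G) (Cbd_nonneg hK)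

/-- The real part of `ℓ` on `⁰𝒮` as a partially defined `ℝ`-linear functional. -/
def ellR (hK : AdmissibleKernel K) : 𝓢((Fin 2 → E4), ℂ) →ₗ.[ℝ] ℝ where
  domain := offDiag.restrictScalars ℝ
  toFun :=
    { toFun := fun F => (ell K F.1).re
      map_add' := fun F G => by
        have hF : IsOffDiagonal F.1 := F.2
        have hG : IsOffDiagonal G.1 := G.2
        simp only [Submodule.coe_add, ell_add hK hF hG, Complex.add_re]
      map_smul' := fun c F => by
        simp only [Submodule.coe_smul_of_tower, RingHom.id_apply, smul_eq_mul]
        rw [real_smul_eq, ell_smul, Complex.re_ofReal_mul] }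

/-- Auxiliary fact `ellR_apply` of the generalised-free-field witness (see the module docstring). [folklore] -/
theorem ellR_apply (hK : AdmissibleKernel K) (F : (ellR hK).domain) : ellR hK F = (ell K F.1).re := rfl

/-- A real-linear extension of `re ∘ ℓ` to the whole Schwartz space, dominated by `N`. -/
theorem exists_extension (hK : AdmissibleKernel K) : ∃ g : 𝓢((Fin 2 → E4), ℂ) →ₗ[ℝ] ℝ,
    (∀ F : 𝓢((Fin 2 → E4), ℂ), IsOffDiagonal F → g F = (ell K F).re) ∧ ∀ F, g F ≤ Nsem hK F := by
  obtain ⟨g, hg1, hg2⟩ := exists_extension_of_le_sublinear (ellR hK) (Nsem hK)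
    (fun c hc F => by rw [real_smul_eq, Nsem_smul, Complex.norm_real, Real.norm_of_nonneg hc.le])
    (Nsem_add hK) (fun F => by
      rw [ellR_apply]
      exact (Complex.re_le_norm _).trans (norm_ell_le hK F.2))
  exact ⟨g, fun F hF => hg1 ⟨F, hF⟩, hg2⟩

/-- The chosen real extension. -/
def gR (hK : AdmissibleKernel K) : 𝓢((Fin 2 → E4), ℂ) →ₗ[ℝ] ℝ := (exists_extension hK).choose

/-- Auxiliary fact `gR_eq` of the generalised-free-field witness (see the module docstring). [folklore] -/
theorem gR_eq (hK : AdmissibleKernel K) {F : 𝓢((Fin 2 → E4), ℂ)} (hF : IsOffDiagonal F) :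
    gR hK F = (ell K F).re :=
  (exists_extension hK).choose_spec.1 F hF

/-- Auxiliary fact `gR_le` of the generalised-free-field witness (see the module docstring). [folklore] -/
theorem gR_le (hK : AdmissibleKernel K) (F : 𝓢((Fin 2 → E4), ℂ)) : gR hK F ≤ Nsem hK F :=
  (exists_extension hK).choose_spec.2 F

/-- Auxiliary fact `Nsem_neg` of the generalised-free-field witness (see the module docstring). [folklore] -/
theorem Nsem_neg (hK : AdmissibleKernel K) (F : 𝓢((Fin 2 → E4), ℂ)) : Nsem hK (-F) = Nsem hK F := by
  rw [← neg_one_smul ℂ F, Nsem_smul]; simp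

/-- The complex-linear extension (algebraic). -/
def Tlin (hK : AdmissibleKernel K) : 𝓢((Fin 2 → E4), ℂ) →ₗ[ℂ] ℂ := Module.Dual.extendRCLike (𝕜 := ℂ) (gR hK)

/-- Auxiliary fact `norm_Tlin_le` of the generalised-free-field witness (see the module docstring). [folklore] -/
theorem norm_Tlin_le (hK : AdmissibleKernel K) (F : 𝓢((Fin 2 → E4), ℂ)) : ‖Tlin hK F‖ ≤ Nsem hK F := by
  have hsq := Module.Dual.norm_extendRCLike_apply_sq (𝕜 := ℂ) (gR hK) F
  have h1 : ‖Tlin hK F‖ ^ 2 ≤ ‖Tlin hK F‖ * Nsem hK F := by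
    calc ‖Tlin hK F‖ ^ 2 = gR hK ((starRingEnd ℂ) (Tlin hK F) • F) := hsq
      _ ≤ Nsem hK ((starRingEnd ℂ) (Tlin hK F) • F) := gR_le hK _
      _ = ‖Tlin hK F‖ * Nsem hK F := by rw [Nsem_smul, RCLike.norm_conj]
  by_cases h0 : ‖Tlin hK F‖ = 0
  · rw [h0]; exact mul_nonneg (Cbd_nonneg hK) (SN_nonneg _ _ _)
  · have hpos : 0 < ‖Tlin hK F‖ := lt_of_le_of_ne (norm_nonneg _) (Ne.symm h0)
    rw [sq] at h1
    exact le_of_mul_le_mul_left h1 hpos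

/-- Auxiliary fact `Tlin_eq` of the generalised-free-field witness (see the module docstring). [folklore] -/
theorem Tlin_eq (hK : AdmissibleKernel K) {F : 𝓢((Fin 2 → E4), ℂ)} (hF : IsOffDiagonal F) :
    Tlin hK F = ell K F := by
  have hIF : IsOffDiagonal ((RCLike.I : ℂ) • F) := hF.smul _
  rw [Tlin, Module.Dual.extendRCLike_apply, gR_eq hK hF, gR_eq hK hIF, ell_smul]
  have hI : (RCLike.I : ℂ) = Complex.I := rfl
  rw [hI]
  apply Complex.ext
  · simp
  · simp

set_option maxRecDepth 20000 in
/-- **The two-point functional** of an admissible kernel: a continuous linear functional on `𝓢((ℝ⁴)², ℂ)`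
which on `⁰𝒮` is integration against `K(x₀ − x₁)` (Hahn–Banach extension). -/
def T (hK : AdmissibleKernel K) : 𝓢((Fin 2 → E4), ℂ) →L[ℂ] ℂ :=
  SchwartzMap.mkCLMtoNormedSpace (𝕜 := ℂ) (σ := RingHom.id ℂ) (Tlin hK) (fun F G => map_add (Tlin hK) F G)
    (fun c F => by rw [map_smul]; rfl)
    ⟨_, Cbd hK, Cbd_nonneg hK, fun F =>
      (norm_Tlin_le hK F).trans (mul_le_mul_of_nonneg_left (SN_le_sup F) (Cbd_nonneg hK))⟩

/-- Auxiliary fact `T_apply` of the generalised-free-field witness (see the module docstring). [folklore] -/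
theorem T_apply (hK : AdmissibleKernel K) (F : 𝓢((Fin 2 → E4), ℂ)) : T hK F = Tlin hK F := rfl

/-- **Representation on `⁰𝒮`.** -/
theorem T_eq_integral (hK : AdmissibleKernel K) {F : 𝓢((Fin 2 → E4), ℂ)} (hF : IsOffDiagonal F) :
    T hK F = ∫ x, KC K x * F x := by
  rw [T_apply, Tlin_eq hK hF, ell]

end Extension

end KernelWitness

end Summit.QuantumFields.YangMills.Theorems.CurvatureKernelBound.Negative
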